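import Literature.AnabelianGeometry.EtaleTheta.Setting
import Literature.AnabelianGeometry.EtaleTheta.SettingCompletion
import Mathlib.Topology.Algebra.Group.Quotient
import Mathlib.GroupTheory.Coset.Defs
import HarnessLib

/-!
# [EtTh] §1 pp. 12–13: "(Δ^tp_Y)^Θ is profinite" — the `Θ`-side reading implies the `Π_X`-side binder
# (proof-only companion; item N8, the hypothesis `hYcl` of `Sec2ThetaGroupCommutators.lean`)

Mochizuki, *The étale theta function and its Frobenioid-theoretic manifestations*, Publ. RIMS **45**
(2009) [EtTh], §1 PRIMS PDF pp. 12–13: "we have a natural exact sequence of abelian profinite groups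
`1 → Δ_Θ → (Δ^tp_Y)^Θ → (Δ^tp_Y)^ell → 1`" [cite: MochizukiEtTh2009, §1 p.12].  Layer L2 of the
abc-iut cell, seat abc-iut-L5-t14 (N8).  PROOF-ONLY, no definition.

The N8 files carry "(Δ^tp_Y)^Θ is profinite" as the `Π_X`-side binder
`hYcl : (ι Δ^tp_Y)⁻ ≤ ι Δ^tp_Y ⊔ [[Δ_X,Δ_X],Δ_X]⁻` (the image of `Δ^tp_Y` in
`Δ^Θ_X = Δ_X/[[Δ_X,Δ_X],Δ_X]⁻` is closed), because the root `Setting.lean` (v3) gives `(Π^tp_X)^Θ` an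
ABSTRACT topology of which only `Continuous toTheta` is recorded, so a compactness statement about
`(Δ^tp_Y)^Θ ⊆ (Π^tp_X)^Θ` alone cannot be used.  This file records, for abc-iut-L2-t1's choice of root
axiom, that the two natural `Θ`-side sentences together DO imply the binder:
`ThetaSetting.closure_map_dtpY_le_of_isQuotientMap` — if `toTheta : Π^tp_X → (Π^tp_X)^Θ` is a
topological quotient map (`Topology.IsQuotientMap`) and `(Δ^tp_Y)^Θ = θ(Δ^tp_Y)` is compact, then
`hYcl` holds.  (Proof: the injection `(Π^tp_X)^Θ → Π_X/[[Δ_X,Δ_X],Δ_X]⁻` induced by `ι` is continuous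
by the quotient property; the image of the compact `θ(Δ^tp_Y)` is compact, hence closed in the
Hausdorff group `Π_X/[[Δ_X,Δ_X],Δ_X]⁻`; its preimage `ι(Δ^tp_Y)·[[Δ_X,Δ_X],Δ_X]⁻` in `Π_X` is closed.)
HONEST FRAMING: [EtTh] is refereed; nothing is asserted about the existence of the setting; no side
is taken on any disputed claim.
-/

noncomputable section

namespace Literature.AnabelianGeometry.EtaleTheta

open Literature.AnabelianGeometry.SemiGraphs
open _root_.Topology
open scoped Pointwise

namespace ThetaSetting

variable {p : ℕ} [Fact p.Prime] (D : ThetaSetting p)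

/-- **"(Δ^tp_Y)^Θ profinite", `Θ`-side ⇒ `Π_X`-side** ([EtTh] pp. 12–13): if `toTheta` is a topological
quotient map and `θ(Δ^tp_Y) ⊆ (Π^tp_X)^Θ` is compact, then the image of `Δ^tp_Y` in
`Δ_X/[[Δ_X,Δ_X],Δ_X]⁻` is closed, i.e. `(ι Δ^tp_Y)⁻ ≤ ι Δ^tp_Y ⊔ [[Δ_X,Δ_X],Δ_X]⁻` (the binder `hYcl` of
`exists_commutator_of_mem_deltaTheta`). [cite: MochizukiEtTh2009, §1 p.12] -/
theorem closure_map_dtpY_le_of_isQuotientMap (hq : IsQuotientMap D.toTheta)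
    (hc : IsCompact ((D.DtpYTheta : Subgroup D.GtpTheta) : Set D.GtpTheta)) :
    (D.DtpY.map D.toHat.toMonoidHom).topologicalClosure ≤
      D.DtpY.map D.toHat.toMonoidHom ⊔ (⁅⁅D.DeltaHat, D.DeltaHat⁆, D.DeltaHat⁆).topologicalClosure := by
  haveI : CompactSpace D.PiHat := D.isProfiniteCompletion_toHat.compactSpace
  haveI : T2Space D.PiHat := D.isProfiniteCompletion_toHat.t2Space
  haveI hΔn : D.DeltaHat.Normal := SettingCompletion.deltaHat_normal D.toTemperedCurve
  haveI hK₃n : (⁅⁅D.DeltaHat, D.DeltaHat⁆, D.DeltaHat⁆).topologicalClosure.Normal :=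
    Subgroup.is_normal_topologicalClosure _
  haveI hK₃c : IsClosed
      (((⁅⁅D.DeltaHat, D.DeltaHat⁆, D.DeltaHat⁆).topologicalClosure : Subgroup D.PiHat) :
        Set D.PiHat) :=
    Subgroup.isClosed_topologicalClosure _
  -- the quotient `Π_X/K₃` and the induced map `φ : (Π^tp_X)^Θ → Π_X/K₃`
  set K₃ := (⁅⁅D.DeltaHat, D.DeltaHat⁆, D.DeltaHat⁆).topologicalClosure with hK₃
  let π : D.PiHat → D.PiHat ⧸ K₃ := QuotientGroup.mk
  let φ : D.GtpTheta → D.PiHat ⧸ K₃ :=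
    fun s => π (D.toHat (Function.surjInv D.toTheta_surjective s))
  have hφ : ∀ g : D.PiTemp, φ (D.toTheta g) = π (D.toHat g) := by
    intro g
    change π (D.toHat (Function.surjInv D.toTheta_surjective (D.toTheta g))) = π (D.toHat g)
    have hg' : D.toTheta (Function.surjInv D.toTheta_surjective (D.toTheta g)) = D.toTheta g :=
      Function.surjInv_eq D.toTheta_surjective _
    have hmem : (Function.surjInv D.toTheta_surjective (D.toTheta g))⁻¹ * g ∈ D.toTheta.ker := by
      rw [MonoidHom.mem_ker, map_mul, map_inv, hg', inv_mul_cancel]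
    rw [D.ker_toTheta, Subgroup.mem_comap, map_mul, map_inv] at hmem
    exact QuotientGroup.eq.mpr hmem
  have hφc : Continuous φ := by
    rw [hq.continuous_iff]
    have : φ ∘ D.toTheta = fun g => π (D.toHat g) := funext hφ
    rw [this]
    exact QuotientGroup.continuous_mk.comp D.toHat.continuous
  -- the image of `θ(Δ^tp_Y)` is `π(ι Δ^tp_Y)`, compact hence closed
  have himg : φ '' ((D.DtpYTheta : Subgroup D.GtpTheta) : Set D.GtpTheta) =
      π '' ((D.DtpY.map D.toHat.toMonoidHom : Subgroup D.PiHat) : Set D.PiHat) := by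
    ext q
    constructor
    · rintro ⟨_, ⟨y, hy, rfl⟩, rfl⟩
      exact ⟨D.toHat y, ⟨y, hy, rfl⟩, (hφ y).symm⟩
    · rintro ⟨_, ⟨y, hy, rfl⟩, rfl⟩
      exact ⟨D.toTheta y, ⟨y, hy, rfl⟩, hφ y⟩
  have hclosed : IsClosed (π '' ((D.DtpY.map D.toHat.toMonoidHom : Subgroup D.PiHat) : Set D.PiHat)) := by
    rw [← himg]
    exact (hc.image hφc).isClosed
  -- its preimage `ι(Δ^tp_Y) · K₃` is closed and equals `ι Δ^tp_Y ⊔ K₃`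
  have hpre : IsClosed (((D.DtpY.map D.toHat.toMonoidHom : Subgroup D.PiHat) : Set D.PiHat) *
      (K₃ : Set D.PiHat)) := by
    rw [← QuotientGroup.preimage_image_mk_eq_mul]
    exact hclosed.preimage QuotientGroup.continuous_mk
  rw [← Subgroup.mul_normal] at hpre
  exact Subgroup.topologicalClosure_minimal _ le_sup_left hpre

end ThetaSetting

end Literature.AnabelianGeometry.EtaleTheta

end
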